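import Summits.BirchSwinnertonDyer.BirchSwinnertonDyer.Theorems.CMKolyvaginAtInertTwoPairSupplyStubUpperAtTwo
import HarnessLib

/-!
# Route `CMKolyvaginAtInertTwo`, crux `CMKolyvaginExactAtInertTwo` (stmt-BirchSwinnertonDyer-24277):
# SUPPLIER of the two-member data, VI — **KOLYVAGIN'S PAIR BOUND `#Ш(E)(2) · #Ш(E^{(d_K)})(2) ≤ 2^{2M₀}` ON H₂ FOR EVERY ODD
# `d_K`** (composite allowed), modulo Gross–Zagier, GZK, modularity and Gross 1991 Prop. 3.7 (2)

Seat `bsd-line-cmk2-p1` g18 (cell `bsd-print-cf2`); helper (`--supports stmt-BirchSwinnertonDyer-24277`).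
THEOREMS ONLY: no definition, no named fact, no `sorry`; no item is closed; BSD is not proved by this.

File V (`…PairSupplyStubUpperAtTwo`) composed the supplier with g16's halves theorem (p705380), which is stated for PRIME `|d_K|`.
The pair inequality itself needs no primality and no Milne: this file records it for EVERY odd `d_K ≠ −3` on H₂ —
`card_primaryComponent_mul_le_two_pow_of_printedInputs`: `#Ш(E/ℚ)(2) · #Ш(E^{(d_K)}/ℚ)(2) ≤ 2^{2M₀}` from the crux's frame (CM,
`2` inert, `ρ̄₂` onto, odd Tamagawa; `K` imaginary quadratic, `Odd d_K`, `d_K ≠ −3`, Heegner; `(Dt, β, ι, d₁)` with `y_K` non-torsion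
and `2^{M₀} ∥ y_K` in `E(K[1])`), GIVEN Gross–Zagier at all levels (24148), GZK (19921), modularity (19273) and the named fact
`GrossLMS1991.prop37_2_reductionCongruence_inert N_E W K`. This is exactly the reach of Kolyvagin's `ℚ`-pair method at `2` on H₂:
by the count identity for composite `d_K` (g15, `…ShaCountCompositeAtTwo`: `#Ш(E_K)(2)·2 = #Ш(E)(2)·#Ш(E^{(d_K)})(2)·2^{Σ}`,
`Σ = Σ_{q ∣ d_K} ([(Δ/q) = −1] + 2[(Δ/q) = 1 ∧ a_q even]) ≥ 1` = `ord₂ ∏_{q ∣ d_K} c_q(E^{(d_K)})`) it yields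
`#Ш(E_K)(2) ≤ 2^{2M₀ + Σ − 1}`, i.e. `stub_upper` exactly when `Σ = 1` (in particular for prime `|d_K|`, file V); for `Σ ≥ 2`
the pair method loses the TWIST'S Tamagawa numbers at the ramified primes (KERNEL-STATUS §18.4 (i)).

References: [Kolyvagin1989Izv] §3, Thm. B_l (l = 2); [McCallumLMS1991] §1 Theorem, §5 Thm. 5.4 "≤"; [GrossLMS1991] §§3–6;
[GrossZagier1986] I (6.3); [SilvermanAEC2009] VIII.§2, X.4.2.
-/

-- single-conjunct summit: `Summit.BirchSwinnertonDyer.BirchSwinnertonDyer.…` repeats the name by design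
set_option linter.dupNamespace false
set_option autoImplicit false

noncomputable section

open scoped Classical
open scoped AddSubgroup

namespace Summit.BirchSwinnertonDyer.BirchSwinnertonDyer.Theorems.KolyvaginPairSupplyTwo

open WeierstrassCurve NumberField IsDedekindDomain Field Rat.HeightOneSpectrum
open Literature.NumberTheory.EllipticCurves Literature.NumberTheory.GaloisRepresentations
open Literature.NumberTheory.EllipticCurves.KolyvaginDescent Literature.NumberTheory.EllipticCurves.ModularForms
open Literature.NumberTheory.EllipticCurves.KolyvaginCocycle
open Literature.NumberTheory.EllipticCurves.RingClassField
open Summit.BirchSwinnertonDyer.Rank1Residual.P2.KolyvaginMachine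
open Summit.BirchSwinnertonDyer.Rank1Residual.X11b
open Summit.BirchSwinnertonDyer.BirchSwinnertonDyer.Theorems.KolyvaginPairDataTwo
open Summit.BirchSwinnertonDyer.BirchSwinnertonDyer.Theorems.GenusExact.VisiblePairAtTwo

/-! ## Kolyvagin's pair bound at `2` on H₂, every odd `d_K` -/

variable (W : WeierstrassCurve ℚ) {K : Type} [Field K] [NumberField K]

set_option maxHeartbeats 3200000 in
/-- **KOLYVAGIN'S PAIR BOUND `#Ш(E)(2) · #Ш(E^{(d_K)})(2) ≤ 2^{2M₀}` ON H₂, EVERY ODD `d_K ≠ −3`**, modulo Gross–Zagier (all levels),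
GZK, modularity and Gross 1991 Prop. 3.7 (2) by name (see the module docstring). [cite: Kolyvagin1989Izv, §3 (Thm. B_l at l = 2)]
[cite: McCallumLMS1991, §1 Theorem, §5 Thm. 5.4 "≤"] [cite: GrossLMS1991, §§3–6 (Props. 3.7, 5.3, 6.2)] [cite: GrossZagier1986, I (6.3)] -/
theorem card_primaryComponent_mul_le_two_pow_of_printedInputs
    -- the route's published inputs (items 24148 / 19921 / 19273)
    (hGZ : ∀ (N : ℕ) [NeZero N] (W : WeierstrassCurve ℚ) (K : Type) [Field K] [NumberField K], gross_zagier N W K)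
    (hGZK : rank_eq_analyticRank_of_analyticRank_le_one) (hmod : hasEntireLFunction_rat)
    [W.IsElliptic] [W.IsGloballyMinimal] [NeZero (W.conductorNorm ℤ)]
    (hCM : W.HasCM) (hin : Literature.NumberTheory.EllipticCurves.Rank1Residual.CMInert W 2)
    (hρ : W.HasSurjectiveModNGaloisRep 2) (hT : Odd W.tamagawaProduct) (hK : IsImaginaryQuadratic K)
    (hoddK : Odd (NumberField.discr K)) (h3 : NumberField.discr K ≠ -3)
    (hH : SatisfiesHeegnerHypothesis (W.conductorNorm ℤ) K)
    -- the one remaining point-system print: Gross 1991 Prop. 3.7 (2) as the tree's named fact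
    (h372 : GrossLMS1991.prop37_2_reductionCongruence_inert (W.conductorNorm ℤ) W K)
    -- the crux's frame and `M₀`-clause
    (Dt : ModularParametrizationData W (W.conductorNorm ℤ)) (β : ℤ) (ιK : K →+* ℂ) (d₁ : KolyvaginHeegnerData Dt β ιK 1)
    (hy : ¬ IsOfFinAddOrder d₁.derivedPoint) (M₀ : ℕ)
    (hdiv : ∃ Q : (W.baseChange (ringClassField K ιK 1)).toAffine.Point, ((2 ^ M₀ : ℕ) : ℤ) • Q = d₁.derivedPoint)
    (hndiv : ¬ ∃ Q : (W.baseChange (ringClassField K ιK 1)).toAffine.Point,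
      ((2 ^ (M₀ + 1) : ℕ) : ℤ) • Q = d₁.derivedPoint) :
    Nat.card (AddCommGroup.primaryComponent W.sha 2) *
      Nat.card (AddCommGroup.primaryComponent (twin W K).sha 2) ≤ 2 ^ (2 * M₀) := by
  have h2 : Module.finrank ℚ K = 2 := hK.1
  have hdQ : ((NumberField.discr K : ℤ) : ℚ) ≠ 0 := by exact_mod_cast NumberField.discr_ne_zero K
  haveI : (twin W K).IsElliptic := W.isElliptic_quadraticTwist hdQ
  obtain ⟨θ, hθ, hd⟩ := Literature.NumberTheory.QuadraticFields.Quadratic.exists_not_mem_range_sq_eq_discr (K := K) h2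
  have hσ1 : sigmaQ K h2 hθ hd ≠ 1 := sigmaQ_ne_one K h2 hθ hd
  have hΔ : W.Δ < 0 := KolyvaginEigenTwo.Δ_neg_of_cmInert_two W hCM hin hρ
  -- the Heegner point `P₀ ∈ E(K)` under `P(1)`
  obtain ⟨P₀, hP₀, hP₀K⟩ := heegnerSystem_exists_isHeegnerPoint_map_eq_derivedPoint_one
    (heegnerPointOfConductor_one_galoisConj_holds (W.conductorNorm ℤ) W K) hK hH d₁
  -- no rational `2`-torsion (stated through `convert` so that both `DecidableEq ℚ` currencies are served, §17.9)
  have hW2n : ∀ P : W.toAffine.Point, 2 • P = 0 → P = 0 := fun P hP ↦ by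
    have h := DokchitserDokchitser2012.forall_two_nsmul_of_hasSurjectiveModNGaloisRep_two W two_ne_zero hρ P (by convert hP)
    convert h
  -- no `2`-torsion over `K`, no `2`-power torsion over `K[1]`
  have h2t : ∀ T : (W.baseChange K).toAffine.Point, (2 : ℤ) • T = 0 → T = 0 := fun T h2T ↦
    GenusExact.EigenClassesFinite.forall_zsmul_two_pow_baseChange_eq_zero_of_hasSurjectiveModNGaloisRep_two W K h2 hρ 1 T
      (by rw [pow_one, Nat.cast_ofNat]; exact h2T)
  haveI := (finiteDimensional_and_isGalois_ringClassField hK ιK one_ne_zero).1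
  haveI : NumberField (ringClassField K ιK 1) := NumberField.of_module_finite K _
  have hD4 : NumberField.discr K % 4 = 1 :=
    (GenusExact.TwinGrossPrimes.discr_emod_four_eq_one_and_squarefree_of_odd h2 hoddK).1
  have h2K1 : ∀ T : (W.baseChange (ringClassField K ιK 1)).toAffine.Point, (2 : ℤ) • T = 0 → T = 0 := fun T h2T ↦
    Uniform.U2.RingClass.forall_two_nsmul_eq_zero_of_heegner W hK ιK hD4 hH
      (fun P hP ↦ by
        have h := hW2n P (by convert hP)
        convert h)
      one_ne_zero T (by rwa [ofNat_zsmul] at h2T)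
  have htorK1 : ∀ (M : ℕ) (R : (W.baseChange (ringClassField K ιK 1)).toAffine.Point),
      ((2 ^ M : ℕ) : ℤ) • R = 0 → R = 0 := fun M R hR ↦
    KolyvaginPairDataTwo.eq_zero_of_two_pow_zsmul_eq_zero h2K1 M R (by rwa [Nat.cast_pow, Nat.cast_ofNat] at hR)
  -- `2^{M₀} ∥ P₀` in `E(K)`
  obtain ⟨x₀, hx₀'⟩ := (Rank1Residual.X11b.Three.Koly.pDiv_one_iff_exists_zsmul_eq hK d₁ P₀ hP₀K 2 M₀ (htorK1 M₀)).mp hdiv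
  have hx₀ : (((2 : ℕ) : ℤ) ^ M₀) • x₀ = P₀ := by rw [← Nat.cast_pow]; exact hx₀'
  have hnd : ∀ Q : (W.baseChange K).toAffine.Point, (((2 : ℕ) : ℤ) ^ (M₀ + 1)) • Q ≠ P₀ := fun Q hQ ↦
    hndiv ((Rank1Residual.X11b.Three.Koly.pDiv_one_iff_exists_zsmul_eq hK d₁ P₀ hP₀K 2 (M₀ + 1)
      (htorK1 (M₀ + 1))).mpr ⟨Q, by rw [Nat.cast_pow]; exact hQ⟩)
  -- rank and finiteness from the facts
  obtain ⟨hrank, hfin₁, hfin₂⟩ := ShaCountTwo.rank_add_eq_one_and_finite_sha_of_heegnerData_of_facts hGZ hGZK hmod W K hK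
    hH Dt β ιK d₁ hy (twin W K) ⟨1, one_smul _ _⟩
  haveI := hfin₁
  haveI := hfin₂
  -- the level
  set L : ℕ := max (max 1 M₀) (max (padicValNat 2 (Nat.card W.sha)) (padicValNat 2 (Nat.card (twin W K).sha)))
    with hLdef
  have hL1 : 1 ≤ L := le_trans (le_max_left 1 M₀) (le_max_left _ _)
  have hM₀L : M₀ ≤ L := le_trans (le_max_right 1 M₀) (le_max_left _ _)
  have hLsha₁ : padicValNat 2 (Nat.card W.sha) ≤ L := le_trans (le_max_left _ _) (le_max_right _ _)
  have hLsha₂ : padicValNat 2 (Nat.card (twin W K).sha) ≤ L := le_trans (le_max_right _ _) (le_max_right _ _)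
  have hM : 1 ≤ L + L := by omega
  -- the point system at level `2^{2L+1}` for `σ₀`
  have hdiv' := (W.baseChange K).zsmul_geomPoints_surjective_holds (lvl_ne_zero (L + L + 1))
  have hdivM := (W.baseChange K).zsmul_geomPoints_surjective_holds (lvl_ne_zero (L + L))
  obtain ⟨ε, τ, hτ, A, hA, Pt, hPt, hε, hc1, hAτ, hPt1, hrel⟩ :=
    Rank1Residual.P2.PointSystemOddTamagawa.hpoints_two_of_cmInert_of_oddTamagawa rfl hCM hin hρ hT hK hoddK h3 hH hP₀ h372
      (Rank1Residual.X11b.KolyvaginLeaves.h53_holds rfl 2) (M := L + L + 1) (by omega) hdiv' (sigmaQ K h2 hθ hd) hσ1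
  let D' : PointSystem (W.conductorNorm ℤ) W K P₀ 2 (kolPrime W K (L + L)) (L + L + 1) hdiv' (sigmaQ K h2 hθ hd) :=
    ⟨ε, τ, hτ, A, hA, Pt, hPt, hε, hc1, hAτ, hPt1,
      fun m hm hq' ↦ hrel m hm fun q hq'' ↦ ⟨(hq' q hq'').1, (hq' q hq'').2.1⟩⟩
  have hLtor : ∀ Q : (W.baseChange K).toAffine.Point, (lvl (L + L + 1) : ℤ) • Q = 0 → Q = 0 :=
    GenusExact.EigenClassesFinite.forall_zsmul_two_pow_baseChange_eq_zero_of_hasSurjectiveModNGaloisRep_two W K h2 hρ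
      (L + L + 1)
  -- no rational `2`-torsion on either member
  -- (stated through the generic-field wrapper so that the `AddCommGroup` instance on the points is the classical one of the
  -- tree's Kummer files; `convert` identifies it with `instDecidableEqRat`'s — KERNEL-STATUS §17.9)
  have hW2 := forall_zsmul_two_eq_zero W fun P hP ↦ by
    have h := hW2n P (by convert hP)
    convert h
  have htw2n : ∀ P : (twin W K).toAffine.Point, 2 • P = 0 → P = 0 := fun P hP ↦
    (forall_two_nsmul_quadraticTwist_iff W hdQ).mpr hW2n P hP
  have htw2 := forall_zsmul_two_eq_zero (twin W K) fun P hP ↦ by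
    have h := htw2n P (by convert hP)
    convert h
  rcases D'.hε with hε1 | hεm1
  · -- BRANCH `ε = 1`: `E` first
    obtain ⟨D, hDp, hDM, hDSel₁, hDSel₂, hDLoc₁, hDLoc₂, hDA₁, hDA₂, hDpl, hDDv, hDKol, hDM₀, -, hDx0⟩ :=
      exists_pairDataM_of_pointSystem W (L + L) hdiv' hdivM hK hoddK hΔ hθ hd hP₀ hM D' hε1 hLtor h2t hx₀ hnd
    have hxord : (((2 : ℕ) : ℤ) ^ (L + L - 1)) • D.x ≠ 0 := by
      have h := D.x_ord
      rwa [hDp, hDM] at h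
    obtain ⟨x₀', hx₀'⟩ := exists_kummerMapTorsion_eq_of_torsionH1ToH1_eq_zero W (L + L) hDx0
    rw [← hx₀'] at hxord
    obtain ⟨hrW, htorsT⟩ := mordellWeilRank_eq_one_of_not_isOfFinAddOrder W hrank
      (not_isOfFinAddOrder_of_kummer_ne_zero W (L + L) hW2 hxord)
    obtain ⟨g, -, hgen, -, -⟩ := KrizLi2019.exists_generator_regulator_eq_of_mordellWeilRank_eq_one W hrW
    obtain ⟨g', k, t₀, hk, ht₀, hx₀'eq, hgen'⟩ := exists_odd_coord_of_kummer_ne_zero W (L + L) hM hW2 g hgen hxord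
    have hkerT : ∀ z : selmerGroup W (lvl (L + L)),
        torsionH1ToH1 W (lvl (L + L)) z = 0 ↔ (z : galH1Torsion W (lvl (L + L))) ∈ AddSubgroup.zmultiples D.x := by
      intro z
      rw [← hx₀']
      exact torsionH1ToH1_eq_zero_iff_mem_zmultiples_of_generator W (L + L) hW2 g' hgen' hk ht₀ hx₀'eq z
    have hinjT : ∀ z : selmerGroup (twin W K) (lvl (L + L)), torsionH1ToH1 (twin W K) (lvl (L + L)) z = 0 → z = 0 :=
      fun z hz ↦ Subtype.ext (eq_zero_of_torsionH1ToH1_eq_zero_of_torsion (twin W K) (L + L) htw2 htorsT hz)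
    have h := card_primaryComponent_mul_le_two_pow_of_pairData_cmInert W hCM hin hρ hK hoddK hH hP₀ hL1 D hDp hDM hDSel₁
      hDSel₂ hDLoc₁ hDLoc₂ hDA₁ hDA₂ hDpl hDDv hDKol (hDM₀ ▸ hM₀L) hLsha₁ hLsha₂ hkerT hinjT
    rwa [hDM₀] at h
  · -- BRANCH `ε = −1`: the twin first
    have hrank' : (twin W K).mordellWeilRank + W.mordellWeilRank = 1 := by rw [add_comm]; exact hrank
    obtain ⟨D, hDp, hDM, hDSel₁, hDSel₂, hDLoc₁, hDLoc₂, hDA₁, hDA₂, hDpl, hDDv, hDKol, hDM₀, -, hDx0⟩ :=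
      exists_pairDataM_twin_of_pointSystem W (L + L) hdiv' hdivM hK hoddK hΔ hθ hd hP₀ hM D' hεm1 hLtor h2t hx₀ hnd
    have hxord : (((2 : ℕ) : ℤ) ^ (L + L - 1)) • D.x ≠ 0 := by
      have h := D.x_ord
      rwa [hDp, hDM] at h
    obtain ⟨x₀', hx₀'⟩ := exists_kummerMapTorsion_eq_of_torsionH1ToH1_eq_zero (twin W K) (L + L) hDx0
    rw [← hx₀'] at hxord
    obtain ⟨hrT, htorsW⟩ := mordellWeilRank_eq_one_of_not_isOfFinAddOrder (twin W K) hrank'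
      (not_isOfFinAddOrder_of_kummer_ne_zero (twin W K) (L + L) htw2 hxord)
    obtain ⟨g, -, hgen, -, -⟩ := KrizLi2019.exists_generator_regulator_eq_of_mordellWeilRank_eq_one (twin W K) hrT
    obtain ⟨g', k, t₀, hk, ht₀, hx₀'eq, hgen'⟩ :=
      exists_odd_coord_of_kummer_ne_zero (twin W K) (L + L) hM htw2 g hgen hxord
    have hkerT : ∀ z : selmerGroup (twin W K) (lvl (L + L)),
        torsionH1ToH1 (twin W K) (lvl (L + L)) z = 0 ↔
          (z : galH1Torsion (twin W K) (lvl (L + L))) ∈ AddSubgroup.zmultiples D.x := by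
      intro z
      rw [← hx₀']
      exact torsionH1ToH1_eq_zero_iff_mem_zmultiples_of_generator (twin W K) (L + L) htw2 g' hgen' hk ht₀ hx₀'eq z
    have hinjT : ∀ z : selmerGroup W (lvl (L + L)), torsionH1ToH1 W (lvl (L + L)) z = 0 → z = 0 :=
      fun z hz ↦ Subtype.ext (eq_zero_of_torsionH1ToH1_eq_zero_of_torsion W (L + L) hW2 htorsW hz)
    have h := card_primaryComponent_mul_le_two_pow_of_pairData_cmInert_neg W hCM hin hρ hK hoddK hH hP₀ hL1 D hDp hDM hDSel₁
      hDSel₂ hDLoc₁ hDLoc₂ hDA₁ hDA₂ hDpl hDDv hDKol (hDM₀ ▸ hM₀L) hLsha₂ hLsha₁ hkerT hinjT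
    rw [hDM₀, mul_comm] at h
    exact h

end Summit.BirchSwinnertonDyer.BirchSwinnertonDyer.Theorems.KolyvaginPairSupplyTwo

end
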